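import Literature.Probability.NegativeDependence.SymmetricExclusionStronglyRayleigh
import Literature.Probability.NegativeDependence.ExchangeableStronglyRayleigh
import Mathlib.Analysis.Calculus.Deriv.MeanValue
import Mathlib.Analysis.Calculus.Deriv.Prod
import Mathlib.Analysis.Calculus.Deriv.Pow
import Mathlib.GroupTheory.Perm.Sign
import HarnessLib

/-!
# The finite symmetric exclusion process converges to the symmetrization of its initial law
# (Borcea–Brändén–Liggett §2.1 (v), §3.5, Remark 5.2; Remark 4.5: `μ_s` is strongly Rayleigh)

J. Borcea, P. Brändén, T. M. Liggett, *Negative dependence and the geometry of polynomials*, J. Amer. Math. Soc.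
22 (2009) 521–567 (arXiv:0707.2340, held `paper:arxiv-0707.2340`; numbering of the arXiv version). Verbatim:

> (§2.1 (v)) *Symmetrization.* Denote the symmetric group on `n` elements by `𝔖_n`. For `σ ∈ 𝔖_n` and `S ⊆ [n]`
> let `σ(S) = {σ(s) : s ∈ S}`. Given `μ ∈ 𝔓_n` define a measure `σ(μ) ∈ 𝔓_n` by setting `σ(μ)(S) = μ(σ(S))`,
> `S ⊆ [n]`. The (full or complete) symmetrization of `μ` is the measure `μ_s = (1/n!) Σ_{σ ∈ 𝔖_n} σ(μ) ∈ 𝔓_n`.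
>
> (§3.5) The (finite) symmetric exclusion process generates a continuous time evolution on the set `𝔓_n`. The
> limiting measure under the symmetric exclusion evolution with initial measure `μ` is the symmetrization `μ_s` of
> `μ` as defined in §2.1. […] Since the limiting distribution of the evolution as `t → ∞` is the symmetrization
> of the initial distribution defined in [§2.1 (v)], any such property would have to be preserved by this
> symmetrization procedure.
>
> (§4.4) **Remark 4.5.** From Theorem 4.20 it follows that the symmetrization `μ_s` of a strongly Rayleigh
> measure `μ` is also strongly Rayleigh. A different proof is as follows. If `μ` is a strongly Rayleigh measure on
> `2^{[n]}` then [§2.1 (v)] implies that the diagonal specialization `Δ(g_{μ_s})(t) = Δ(g_μ)(t)` is a real-rooted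
> univariate polynomial and by the Grace–Walsh–Szegö theorem we conclude that the symmetrization `μ_s` of `μ` is
> also strongly Rayleigh.
>
> (§5) **Remark 5.2.** If `q_{i,j} > 0` for all `i, j`, then as we noted in §3.5 the limiting distribution of
> `η_t` as `t → ∞` is the symmetrization of the initial distribution.

## What is here, and the proof

The process, its generator `𝓛 = Σ_{i,j} ½ q_{i,j} (τ_{i,j} - 1)` and its transition semigroup `μ ↦ μ T(t) = sepLaw q t μ`
are those of `SymmetricExclusionStronglyRayleigh.lean` (weights `μ : Finset σ → ℝ` on `2^σ`). BBL state the
convergence `μ T(t) → μ_s` (rates `q_{i,j} > 0` for `i ≠ j`) without proof, as a standard fact about finite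
symmetric Markov chains [Liggett1985, Ch. VIII]. The proof written here is the `ℓ²` (Dirichlet form) argument:
with `E(ν) = Σ_S ν(S)²` and `D(ν) = Σ_{i,j} ½ q_{i,j} Σ_S (ν(τ_{i,j}S) - ν(S))²` one has `d/dt E(μT(t)) = -D(μT(t))`
(`hasDerivAt_energy_sepLaw`); `D(ν) = 0` forces `ν` to be invariant under every transposition, hence under `𝔖_σ`
(`Equiv.Perm.swap_induction_on`), hence `ν = ν_s`; so by compactness of the unit `E`-sphere of the finite-dimensional
space `{ν : ν_s = 0}` there is a spectral gap `D ≥ λ E` there (`exists_gap`); `𝓛` kills symmetric weights and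
symmetrization kills `𝓛`, so `μT(t) - μ_s = (μ - μ_s)T(t)` stays in that space and `E(μT(t) - μ_s) ≤ e^{-λt} E(μ - μ_s)`
(`energy_sepLaw_sub_symmW_le`), whence `μ T(t) → μ_s` (`tendsto_sepLaw_atTop`). Remark 4.5 then follows "from
Theorem 4.20" exactly as printed: `μ_s = lim_t μT(t)` is a limit of strongly Rayleigh weights (Prop. 5.1,
`stableOrZero_sepLaw`) and the strongly Rayleigh class is closed (`StableOrZero.of_tendsto`).

## Contents (namespace `Literature.Probability.NegativeDependence`)

* §1 `symmW μ = μ_s` (Def. §2.1 (v)), `symmW_apply`, linearity, `symmW_apply_image` / `isExchangeable_symmW`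
  (`μ_s` is exchangeable), `symmW_eq_self_of_forall` / `IsExchangeable.symmW_eq`, `symmW_symmW`, `symmW_swapWeight`,
  `swapWeight_symmW`, `mass_symmW`, `rankSeq_symmW` (`Δ(g_{μ_s}) = Δ(g_μ)`), `symmW_nonneg`.
* §2 `excGen_symmW` (`μ_s 𝓛 = 0`), `symmW_partialSymmWeight`, `sepLaw_symmW` (`μ_s T(t) = μ_s`), `symmW_sepLaw`
  (`(μT(t))_s = μ_s`).
* §3 `energy`, `dirichlet`, `sum_mul_sub_swap`, `sum_mul_excGen_apply` (`⟨ν, ν𝓛⟩ = -½ D(ν)`),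
  **`hasDerivAt_energy_sepLaw`** (`d/dt E = -D`).
* §4 `forall_swap_of_dirichlet_eq_zero`, `symmW_eq_self_of_forall_swap`, **`exists_gap`**.
* §5 **`energy_sepLaw_sub_symmW_le`** (exponential convergence in `ℓ²`), **`tendsto_sepLaw_atTop`** (= §3.5 /
  Remark 5.2: `μ T(t) → μ_s`).
* §6 **`stableOrZero_symmW`** (= Remark 4.5), `isCNAPlus_symmW`.

No `sorry`, no named fact, no instance/notation; definitions with bodies.

## References

* [BorceaBrandenLiggett2007] J. Borcea, P. Brändén, T. M. Liggett, Negative dependence and the geometry of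
  polynomials, J. Amer. Math. Soc. 22 (2009); arXiv:0707.2340 — §2.1 (v), §3.5 (before Problem 3.5), §4.4
  Remark 4.5, §5 Remark 5.2.
* [Liggett1985] T. M. Liggett, Interacting Particle Systems, Springer 1985 — Ch. VIII (symmetric exclusion).
-/

noncomputable section

open Finset Filter Topology NormedSpace
open Literature.Combinatorics.Sahi2008
open Literature.Combinatorics.StablePolynomials

namespace Literature.Probability.NegativeDependence

variable {σ : Type*} [Fintype σ] [DecidableEq σ]

/-! ## §1 The symmetrization `μ_s` of a weight -/

section Symmetrization

/-- **The symmetrization** `μ_s = (1/n!) Σ_{σ ∈ 𝔖_n} σ(μ)`, `σ(μ)(S) = μ(σ(S))` (here `n! = |𝔖_σ|`).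
[cite: BorceaBrandenLiggett2007, §2.1 (v)] -/
def symmW (μ : Finset σ → ℝ) : Finset σ → ℝ := fun S =>
  (Fintype.card (Equiv.Perm σ) : ℝ)⁻¹ * ∑ e : Equiv.Perm σ, μ (S.image e)

/-- Unfolding `symmW`. [cite: BorceaBrandenLiggett2007, §2.1 (v)] -/
theorem symmW_apply (μ : Finset σ → ℝ) (S : Finset σ) :
    symmW μ S = (Fintype.card (Equiv.Perm σ) : ℝ)⁻¹ * ∑ e : Equiv.Perm σ, μ (S.image e) := rfl

/-- `|𝔖_σ| = n! ≠ 0`. [cite: BorceaBrandenLiggett2007, §2.1 (v)] -/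
theorem card_perm_pos : (0 : ℝ) < Fintype.card (Equiv.Perm σ) := by
  exact_mod_cast Fintype.card_pos

/-- Symmetrization is additive. [cite: BorceaBrandenLiggett2007, §2.1 (v)] -/
theorem symmW_add (μ ν : Finset σ → ℝ) : symmW (μ + ν) = symmW μ + symmW ν := by
  funext S
  simp only [symmW_apply, Pi.add_apply, sum_add_distrib, mul_add]

/-- Symmetrization commutes with scalars. [cite: BorceaBrandenLiggett2007, §2.1 (v)] -/
theorem symmW_smul (c : ℝ) (μ : Finset σ → ℝ) : symmW (c • μ) = c • symmW μ := by
  funext S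
  simp only [symmW_apply, Pi.smul_apply, smul_eq_mul, ← mul_sum]
  ring

/-- Symmetrization is subtractive. [cite: BorceaBrandenLiggett2007, §2.1 (v)] -/
theorem symmW_sub (μ ν : Finset σ → ℝ) : symmW (μ - ν) = symmW μ - symmW ν := by
  funext S
  simp only [symmW_apply, Pi.sub_apply, sum_sub_distrib, mul_sub]

/-- `symmW 0 = 0`. [cite: BorceaBrandenLiggett2007, §2.1 (v)] -/
theorem symmW_zero : symmW (0 : Finset σ → ℝ) = 0 := by
  funext S
  simp [symmW_apply]

omit [Fintype σ] in
/-- `σ'(σ(S)) = (σ' ∘ σ)(S)`. [cite: BorceaBrandenLiggett2007, §2.1 (v) (`σ(S) = {σ(s) : s ∈ S}`)] -/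
theorem image_image_perm (S : Finset σ) (e f : Equiv.Perm σ) : (S.image e).image f = S.image ⇑(f * e) := by
  rw [image_image]; rfl

/-- **`μ_s` is exchangeable**: `μ_s(σ(S)) = μ_s(S)` (re-index the average by `σ' ↦ σ'σ`).
[cite: BorceaBrandenLiggett2007, §2.1 (v), Def. 2.1] -/
theorem symmW_apply_image (μ : Finset σ → ℝ) (e : Equiv.Perm σ) (S : Finset σ) :
    symmW μ (S.image e) = symmW μ S := by
  simp only [symmW_apply, image_image_perm]
  congr 1
  exact Fintype.sum_equiv (Equiv.mulRight e) _ _ fun f => rfl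

/-- `μ_s` is exchangeable in the sense of the tree's `IsExchangeable` (Def. 2.1).
[cite: BorceaBrandenLiggett2007, §2.1 Def. 2.1, (v)] -/
theorem isExchangeable_symmW (μ : Finset σ → ℝ) : IsExchangeable (symmW μ) := fun e S => by
  rw [map_eq_image, Equiv.coe_toEmbedding]
  exact symmW_apply_image μ e S

/-- A weight invariant under all permutations is its own symmetrization. [cite: BorceaBrandenLiggett2007, §2.1
(v), Def. 2.1 (`σ(μ) = μ`)] -/
theorem symmW_eq_self_of_forall {μ : Finset σ → ℝ} (h : ∀ (e : Equiv.Perm σ) (S : Finset σ), μ (S.image e) = μ S) :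
    symmW μ = μ := by
  funext S
  simp only [symmW_apply, h, sum_const, card_univ, nsmul_eq_mul]
  rw [← mul_assoc, inv_mul_cancel₀ card_perm_pos.ne', one_mul]

/-- An exchangeable weight is its own symmetrization. [cite: BorceaBrandenLiggett2007, §2.1 Def. 2.1, (v)] -/
theorem IsExchangeable.symmW_eq {μ : Finset σ → ℝ} (h : IsExchangeable μ) : symmW μ = μ :=
  symmW_eq_self_of_forall fun e S => by
    have h' := h e S
    rwa [map_eq_image, Equiv.coe_toEmbedding] at h'

/-- Symmetrization is idempotent. [cite: BorceaBrandenLiggett2007, §2.1 (v)] -/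
theorem symmW_symmW (μ : Finset σ → ℝ) : symmW (symmW μ) = symmW μ :=
  (isExchangeable_symmW μ).symmW_eq

/-- `(τ_{a,b} μ)_s = μ_s`. [cite: BorceaBrandenLiggett2007, §2.1 (v), (vi)] -/
theorem symmW_swapWeight (a b : σ) (μ : Finset σ → ℝ) : symmW (swapWeight a b μ) = symmW μ := by
  funext S
  simp only [symmW_apply, swapWeight_apply, image_image_perm]
  congr 1
  exact Fintype.sum_equiv (Equiv.mulLeft (Equiv.swap a b)) _ _ fun f => rfl

/-- `τ_{a,b}(μ_s) = μ_s`. [cite: BorceaBrandenLiggett2007, §2.1 (v), (vi)] -/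
theorem swapWeight_symmW (a b : σ) (μ : Finset σ → ℝ) : swapWeight a b (symmW μ) = symmW μ := by
  funext S
  rw [swapWeight_apply, symmW_apply_image]

/-- `Σ_S μ(σ(S)) = Σ_S μ(S)`. [cite: BorceaBrandenLiggett2007, §2.1 (v)] -/
theorem sum_apply_image_perm (μ : Finset σ → ℝ) (e : Equiv.Perm σ) :
    ∑ S : Finset σ, μ (S.image e) = ∑ S, μ S :=
  Fintype.sum_equiv (Equiv.finsetCongr e) _ _ fun S => by
    rw [Equiv.finsetCongr_apply, map_eq_image, Equiv.coe_toEmbedding]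

/-- Symmetrization preserves the total mass: `μ_s ∈ 𝔓_n`. [cite: BorceaBrandenLiggett2007, §2.1 (v)] -/
theorem mass_symmW (μ : Finset σ → ℝ) : mass (symmW μ) = mass μ := by
  simp only [mass_def, symmW_apply, ← mul_sum]
  rw [sum_comm]
  simp only [sum_apply_image_perm, sum_const, card_univ, nsmul_eq_mul]
  rw [← mul_assoc, inv_mul_cancel₀ card_perm_pos.ne', one_mul]

/-- Symmetrization preserves the rank sequence `r_k = μ(|S| = k)` ("`Δ(g_{μ_s}) = Δ(g_μ)`").
[cite: BorceaBrandenLiggett2007, §4.4 Remark 4.5, §2.1 Def. 2.8] -/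
theorem rankSeq_symmW (μ : Finset σ → ℝ) (k : ℕ) : rankSeq (symmW μ) k = rankSeq μ k := by
  have hre : ∀ e : Equiv.Perm σ, ∑ S ∈ powersetCard k univ, μ (S.image e) = ∑ S ∈ powersetCard k univ, μ S := by
    intro e
    refine sum_equiv (Equiv.finsetCongr e) (fun S => ?_) (fun S _ => ?_)
    · simp only [mem_powersetCard, subset_univ, true_and, Equiv.finsetCongr_apply, card_map]
    · rw [Equiv.finsetCongr_apply, map_eq_image, Equiv.coe_toEmbedding]
  simp only [rankSeq_def, symmW_apply, ← mul_sum]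
  rw [sum_comm]
  simp only [hre, sum_const, card_univ, nsmul_eq_mul]
  rw [← mul_assoc, inv_mul_cancel₀ card_perm_pos.ne', one_mul]

/-- `μ_s ≥ 0` for `μ ≥ 0`. [cite: BorceaBrandenLiggett2007, §2.1 (v)] -/
theorem symmW_nonneg {μ : Finset σ → ℝ} (h : ∀ S, 0 ≤ μ S) (S : Finset σ) : 0 ≤ symmW μ S :=
  mul_nonneg (inv_nonneg.2 card_perm_pos.le) (sum_nonneg fun _ _ => h _)

/-- Symmetrization is continuous in the weight. [cite: BorceaBrandenLiggett2007, §2.1 (v)] -/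
theorem continuous_symmW : Continuous fun μ : Finset σ → ℝ => symmW μ := by
  refine continuous_pi fun S => ?_
  simp only [symmW_apply]
  exact continuous_const.mul (continuous_finsetSum _ fun e _ => continuous_apply _)

end Symmetrization

/-! ## §2 The generator kills symmetric weights; the semigroup fixes `μ_s` and preserves `(·)_s` -/

section Generator

/-- `μ_s 𝓛 = 0`: the symmetrization is `𝓛`-harmonic (each `τ_{i,j} μ_s - μ_s = 0`).
[cite: BorceaBrandenLiggett2007, §3.5 ("the limiting measure … is the symmetrization"), §5 proof of Prop. 5.1] -/
theorem excGen_symmW (q : σ → σ → ℝ) (μ : Finset σ → ℝ) : excGen q (symmW μ) = 0 := by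
  funext S
  rw [excGen_apply]
  refine sum_eq_zero fun a _ => sum_eq_zero fun b _ => ?_
  rw [show symmW μ (S.image (Equiv.swap a b)) = swapWeight a b (symmW μ) S from rfl, swapWeight_symmW, sub_self,
    mul_zero]

/-- `(ν^{τ,θ})_s = ν_s`: partial symmetrization does not change the symmetrization.
[cite: BorceaBrandenLiggett2007, §2.1 (v), (vi)] -/
theorem symmW_partialSymmWeight (θ : ℝ) (a b : σ) (ν : Finset σ → ℝ) :
    symmW (partialSymmWeight θ a b ν) = symmW ν := by
  rw [partialSymmWeight, symmW_add, symmW_smul, symmW_smul, symmW_swapWeight]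
  funext S
  simp only [Pi.add_apply, Pi.smul_apply, smul_eq_mul]
  ring

/-- `(μ_s)^{τ,θ} = μ_s`. [cite: BorceaBrandenLiggett2007, §2.1 (v), (vi)] -/
theorem partialSymmWeight_symmW (θ : ℝ) (a b : σ) (μ : Finset σ → ℝ) :
    partialSymmWeight θ a b (symmW μ) = symmW μ := by
  rw [partialSymmWeight, swapWeight_symmW]
  funext S
  simp only [Pi.add_apply, Pi.smul_apply, smul_eq_mul]
  ring

/-- **`μ_s` is stationary**: `μ_s T(t) = μ_s` (`t ≥ 0`, rates `≥ 0`). [cite: BorceaBrandenLiggett2007, §3.5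
("the limiting measure under the symmetric exclusion evolution … is the symmetrization"), §5 Remark 5.2] -/
theorem sepLaw_symmW {q : σ → σ → ℝ} (hq : ∀ a b, 0 ≤ q a b) {t : ℝ} (ht : 0 ≤ t) (μ : Finset σ → ℝ) :
    sepLaw q t (symmW μ) = symmW μ := by
  have h := sepLaw_mem_of_isClosed (M := {ν | ν = symmW μ}) isClosed_singleton
    (fun a b θ _ _ ν hν => by
      simp only [Set.mem_setOf_eq] at hν ⊢
      rw [hν, partialSymmWeight_symmW]) hq ht (μ := symmW μ) rfl
  simpa using h

/-- **The evolution preserves the symmetrization**: `(μ T(t))_s = μ_s` (`t ≥ 0`, rates `≥ 0`).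
[cite: BorceaBrandenLiggett2007, §3.5, §5 Remark 5.2] -/
theorem symmW_sepLaw {q : σ → σ → ℝ} (hq : ∀ a b, 0 ≤ q a b) {t : ℝ} (ht : 0 ≤ t) (μ : Finset σ → ℝ) :
    symmW (sepLaw q t μ) = symmW μ := by
  have hM : IsClosed {ν : Finset σ → ℝ | symmW ν = symmW μ} := isClosed_eq continuous_symmW continuous_const
  exact sepLaw_mem_of_isClosed hM (fun a b θ _ _ ν hν => by
    simp only [Set.mem_setOf_eq] at hν ⊢
    rw [symmW_partialSymmWeight, hν]) hq ht (μ := μ) rfl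

/-- `T(t)` is linear: `(μ - ν) T(t) = μ T(t) - ν T(t)`. [cite: BorceaBrandenLiggett2007, §5 proof of Prop. 5.1
(the semigroup `T(t)`)] -/
theorem sepLaw_sub (q : σ → σ → ℝ) (t : ℝ) (μ ν : Finset σ → ℝ) :
    sepLaw q t (μ - ν) = sepLaw q t μ - sepLaw q t ν := by
  simp only [sepLaw_def, map_sub]

end Generator

/-! ## §3 The `ℓ²` energy and the Dirichlet form; `d/dt E(μ T(t)) = -D(μ T(t))` -/

section Energy

omit [DecidableEq σ] in
/-- The `ℓ²` energy `E(ν) = Σ_S ν(S)²`. [cite: Liggett1985, Ch. VIII (symmetric exclusion; `ℓ²` methods)]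
[cite: BorceaBrandenLiggett2007, §3.5] -/
def energy (ν : Finset σ → ℝ) : ℝ := ∑ S, ν S ^ 2

omit [DecidableEq σ] in
/-- Unfolding `energy`. [cite: BorceaBrandenLiggett2007, §3.5] -/
theorem energy_def (ν : Finset σ → ℝ) : energy ν = ∑ S, ν S ^ 2 := rfl

omit [DecidableEq σ] in
/-- `E ≥ 0`. [cite: BorceaBrandenLiggett2007, §3.5] -/
theorem energy_nonneg (ν : Finset σ → ℝ) : 0 ≤ energy ν := sum_nonneg fun _ _ => sq_nonneg _

omit [DecidableEq σ] in
/-- `ν(S)² ≤ E(ν)`. [cite: BorceaBrandenLiggett2007, §3.5] -/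
theorem sq_le_energy (ν : Finset σ → ℝ) (S : Finset σ) : ν S ^ 2 ≤ energy ν :=
  single_le_sum (f := fun S => ν S ^ 2) (fun _ _ => sq_nonneg _) (mem_univ S)

omit [DecidableEq σ] in
/-- `E(ν) = 0 ⟺ ν = 0`. [cite: BorceaBrandenLiggett2007, §3.5] -/
theorem energy_eq_zero_iff (ν : Finset σ → ℝ) : energy ν = 0 ↔ ν = 0 := by
  rw [energy_def, sum_eq_zero_iff_of_nonneg fun S _ => sq_nonneg (ν S)]
  constructor
  · intro h; funext S; exact pow_eq_zero_iff two_ne_zero |>.1 (h S (mem_univ S))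
  · intro h S _; rw [h]; simp

omit [DecidableEq σ] in
/-- `E(cν) = c² E(ν)`. [cite: BorceaBrandenLiggett2007, §3.5] -/
theorem energy_smul (c : ℝ) (ν : Finset σ → ℝ) : energy (c • ν) = c ^ 2 * energy ν := by
  simp only [energy_def, Pi.smul_apply, smul_eq_mul, mul_pow, mul_sum]

omit [DecidableEq σ] in
/-- `E` is continuous. [cite: BorceaBrandenLiggett2007, §3.5] -/
theorem continuous_energy : Continuous fun ν : Finset σ → ℝ => energy ν := by
  simp only [energy_def]
  exact continuous_finsetSum _ fun S _ => by fun_prop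

/-- **The Dirichlet form** of the exclusion generator: `D(ν) = Σ_{i,j} ½ q_{i,j} Σ_S (ν(τ_{i,j} S) - ν(S))²`.
[cite: Liggett1985, Ch. VIII] [cite: BorceaBrandenLiggett2007, §5 proof of Prop. 5.1 (`𝓛 = Σ 𝓛_{i,j}`)] -/
def dirichlet (q : σ → σ → ℝ) (ν : Finset σ → ℝ) : ℝ :=
  ∑ a, ∑ b, q a b / 2 * ∑ S, (ν (S.image (Equiv.swap a b)) - ν S) ^ 2

/-- Unfolding `dirichlet`. [cite: BorceaBrandenLiggett2007, §5 proof of Prop. 5.1] -/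
theorem dirichlet_def (q : σ → σ → ℝ) (ν : Finset σ → ℝ) :
    dirichlet q ν = ∑ a, ∑ b, q a b / 2 * ∑ S, (ν (S.image (Equiv.swap a b)) - ν S) ^ 2 := rfl

/-- `D ≥ 0` for nonnegative rates. [cite: BorceaBrandenLiggett2007, §5 proof of Prop. 5.1] -/
theorem dirichlet_nonneg {q : σ → σ → ℝ} (hq : ∀ a b, 0 ≤ q a b) (ν : Finset σ → ℝ) : 0 ≤ dirichlet q ν :=
  sum_nonneg fun a _ => sum_nonneg fun b _ =>
    mul_nonneg (div_nonneg (hq a b) zero_le_two) (sum_nonneg fun _ _ => sq_nonneg _)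

/-- `D(cν) = c² D(ν)`. [cite: BorceaBrandenLiggett2007, §5 proof of Prop. 5.1] -/
theorem dirichlet_smul (q : σ → σ → ℝ) (c : ℝ) (ν : Finset σ → ℝ) :
    dirichlet q (c • ν) = c ^ 2 * dirichlet q ν := by
  rw [dirichlet_def, dirichlet_def, mul_sum]
  refine sum_congr rfl fun a _ => ?_
  rw [mul_sum]
  refine sum_congr rfl fun b _ => ?_
  have hX : ∑ S, ((c • ν) (S.image (Equiv.swap a b)) - (c • ν) S) ^ 2 =
      c ^ 2 * ∑ S, (ν (S.image (Equiv.swap a b)) - ν S) ^ 2 := by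
    rw [mul_sum]
    exact sum_congr rfl fun S _ => by simp only [Pi.smul_apply, smul_eq_mul]; ring
  rw [hX]
  ring

/-- `D` is continuous. [cite: BorceaBrandenLiggett2007, §5 proof of Prop. 5.1] -/
theorem continuous_dirichlet (q : σ → σ → ℝ) : Continuous fun ν : Finset σ → ℝ => dirichlet q ν := by
  simp only [dirichlet_def]
  refine continuous_finsetSum _ fun a _ => continuous_finsetSum _ fun b _ => continuous_const.mul ?_
  exact continuous_finsetSum _ fun S _ => by fun_prop

/-- `Σ_S ν(S) (ν(τS) - ν(S)) = -½ Σ_S (ν(τS) - ν(S))²` (`τ` an involutive re-indexing of `2^σ`).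
[cite: Liggett1985, Ch. VIII] [cite: BorceaBrandenLiggett2007, §5 proof of Prop. 5.1] -/
theorem sum_mul_sub_swap (a b : σ) (ν : Finset σ → ℝ) :
    ∑ S, ν S * (ν (S.image (Equiv.swap a b)) - ν S) =
      -(1 / 2) * ∑ S, (ν (S.image (Equiv.swap a b)) - ν S) ^ 2 := by
  have hsq : ∑ S : Finset σ, ν (S.image (Equiv.swap a b)) ^ 2 = ∑ S, ν S ^ 2 :=
    sum_apply_image_perm (fun S => ν S ^ 2) (Equiv.swap a b)
  have h1 : ∑ S : Finset σ, (ν (S.image (Equiv.swap a b)) - ν S) ^ 2 =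
      2 * ∑ S, ν S ^ 2 - 2 * ∑ S, ν S * ν (S.image (Equiv.swap a b)) := by
    have : ∀ S : Finset σ, (ν (S.image (Equiv.swap a b)) - ν S) ^ 2 =
        ν (S.image (Equiv.swap a b)) ^ 2 + ν S ^ 2 - 2 * (ν S * ν (S.image (Equiv.swap a b))) := fun S => by ring
    simp only [this, sum_sub_distrib, sum_add_distrib, ← mul_sum, hsq]
    ring
  rw [h1]
  simp only [mul_sub, sum_sub_distrib]
  have h2 : ∑ S : Finset σ, ν S * ν S = ∑ S, ν S ^ 2 := sum_congr rfl fun S _ => by ring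
  rw [h2]
  ring

/-- `⟨ν, ν𝓛⟩ = -½ D(ν)`: `Σ_S ν(S) (ν𝓛)(S) = -½ D(ν)`. [cite: Liggett1985, Ch. VIII]
[cite: BorceaBrandenLiggett2007, §5 proof of Prop. 5.1] -/
theorem sum_mul_excGen_apply (q : σ → σ → ℝ) (ν : Finset σ → ℝ) :
    ∑ S, ν S * excGen q ν S = -(1 / 2) * dirichlet q ν := by
  have hL : ∀ S, ν S * excGen q ν S =
      ∑ a, ∑ b, q a b / 2 * (ν S * (ν (S.image (Equiv.swap a b)) - ν S)) := by
    intro S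
    rw [excGen_apply, mul_sum]
    refine sum_congr rfl fun a _ => ?_
    rw [mul_sum]
    exact sum_congr rfl fun b _ => by ring
  simp only [hL]
  rw [sum_comm, dirichlet_def, mul_sum]
  refine sum_congr rfl fun a _ => ?_
  rw [sum_comm, mul_sum]
  refine sum_congr rfl fun b _ => ?_
  rw [← mul_sum, sum_mul_sub_swap]
  ring

/-- **`d/dt E(μ T(t)) = -D(μ T(t))`** (differentiate `Σ_S (μT(t))(S)²` with the forward equation
`d/dt μT(t) = (μT(t))𝓛`). [cite: Liggett1985, Ch. VIII] [cite: BorceaBrandenLiggett2007, §3.5, §5] -/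
theorem hasDerivAt_energy_sepLaw (q : σ → σ → ℝ) (μ : Finset σ → ℝ) (t : ℝ) :
    HasDerivAt (fun s => energy (sepLaw q s μ)) (-dirichlet q (sepLaw q t μ)) t := by
  have hco : ∀ S, HasDerivAt (fun s => sepLaw q s μ S) (excGen q (sepLaw q t μ) S) t := fun S =>
    (hasDerivAt_pi.1 (hasDerivAt_sepLaw q μ t)) S
  have hsum : HasDerivAt (fun s => energy (sepLaw q s μ))
      (∑ S ∈ univ, ((2 : ℕ) : ℝ) * sepLaw q t μ S ^ (2 - 1) * excGen q (sepLaw q t μ) S) t :=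
    HasDerivAt.fun_sum fun S _ => (hco S).fun_pow 2
  refine hsum.congr_deriv ?_
  have h := sum_mul_excGen_apply q (sepLaw q t μ)
  calc ∑ S ∈ univ, ((2 : ℕ) : ℝ) * sepLaw q t μ S ^ (2 - 1) * excGen q (sepLaw q t μ) S
      = 2 * ∑ S, sepLaw q t μ S * excGen q (sepLaw q t μ) S := by
        rw [mul_sum]; exact sum_congr rfl fun S _ => by norm_num; ring
    _ = -dirichlet q (sepLaw q t μ) := by rw [h]; ring

end Energy

/-! ## §4 The spectral gap: `D ≥ λ E` on `{ν : ν_s = 0}` when all rates are positive -/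

section Gap

omit [Fintype σ] in
/-- `τ_{a,a} = 1`. [cite: BorceaBrandenLiggett2007, §5] -/
theorem image_swap_self (a : σ) (S : Finset σ) : S.image (Equiv.swap a a) = S := by
  rw [Equiv.swap_self]
  exact image_id

/-- `D(ν) = 0` with all rates `q_{i,j} > 0` (`i ≠ j`) forces `ν(τ_{i,j} S) = ν(S)` for all `i, j, S`.
[cite: BorceaBrandenLiggett2007, §5 Remark 5.2 (`q_{i,j} > 0` for all `i, j`)] -/
theorem forall_swap_of_dirichlet_eq_zero {q : σ → σ → ℝ} (hq : ∀ a b, 0 ≤ q a b)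
    (hq' : ∀ a b, a ≠ b → 0 < q a b) {ν : Finset σ → ℝ} (h : dirichlet q ν = 0) (a b : σ) (S : Finset σ) :
    ν (S.image (Equiv.swap a b)) = ν S := by
  by_cases hab : a = b
  · subst hab; rw [image_swap_self]
  have hterm : ∀ a b, 0 ≤ q a b / 2 * ∑ S, (ν (S.image (Equiv.swap a b)) - ν S) ^ 2 := fun a b =>
    mul_nonneg (div_nonneg (hq a b) zero_le_two) (sum_nonneg fun S _ => sq_nonneg _)
  rw [dirichlet_def, sum_eq_zero_iff_of_nonneg fun a _ => sum_nonneg fun b _ => hterm a b] at h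
  have ha := h a (mem_univ a)
  rw [sum_eq_zero_iff_of_nonneg fun b _ => hterm a b] at ha
  have hb := ha b (mem_univ b)
  rcases mul_eq_zero.1 hb with h0 | h0
  · exact absurd h0 (div_pos (hq' a b hab) two_pos).ne'
  · rw [sum_eq_zero_iff_of_nonneg fun S _ => sq_nonneg _] at h0
    have := h0 S (mem_univ S)
    rw [pow_eq_zero_iff two_ne_zero, sub_eq_zero] at this
    exact this

/-- A weight invariant under all transpositions is invariant under `𝔖_σ`, hence equals its symmetrization
(transpositions generate `𝔖_σ`). [cite: BorceaBrandenLiggett2007, §2.1 (v), Def. 2.1] -/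
theorem symmW_eq_self_of_forall_swap {ν : Finset σ → ℝ}
    (h : ∀ (a b : σ) (S : Finset σ), ν (S.image (Equiv.swap a b)) = ν S) : symmW ν = ν := by
  refine symmW_eq_self_of_forall fun e => ?_
  induction e using Equiv.Perm.swap_induction_on with
  | one => intro S; simp
  | swap_mul f x y _ ih =>
    intro S
    rw [← image_image_perm, h, ih]

/-- **Spectral gap.** If `q_{i,j} > 0` for all `i ≠ j` there is `λ > 0` with `λ E(ν) ≤ D(ν)` for every weight with
`ν_s = 0` (compactness of the `E`-unit sphere of the finite-dimensional space `{ν_s = 0}`, on which `D > 0` by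
`forall_swap_of_dirichlet_eq_zero` and `symmW_eq_self_of_forall_swap`). [cite: BorceaBrandenLiggett2007, §3.5
(convergence to `μ_s`), §5 Remark 5.2] [cite: Liggett1985, Ch. VIII] -/
theorem exists_gap {q : σ → σ → ℝ} (hq : ∀ a b, 0 ≤ q a b) (hq' : ∀ a b, a ≠ b → 0 < q a b) :
    ∃ lam : ℝ, 0 < lam ∧ ∀ ν : Finset σ → ℝ, symmW ν = 0 → lam * energy ν ≤ dirichlet q ν := by
  set K : Set (Finset σ → ℝ) := {ν | symmW ν = 0 ∧ energy ν = 1} with hK_def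
  have hKc : IsClosed K :=
    (isClosed_eq continuous_symmW continuous_const).inter (isClosed_eq continuous_energy continuous_const)
  have hKb : Bornology.IsBounded K := by
    rw [isBounded_iff_forall_norm_le]
    refine ⟨1, fun ν hν => ?_⟩
    refine (pi_norm_le_iff_of_nonneg zero_le_one).2 fun S => ?_
    rw [Real.norm_eq_abs, ← sq_le_one_iff_abs_le_one, ← hν.2]
    exact sq_le_energy ν S
  have hKcpt : IsCompact K := Metric.isCompact_of_isClosed_isBounded hKc hKb
  by_cases hKne : K.Nonempty
  · obtain ⟨ν₀, hν₀K, hmin⟩ := hKcpt.exists_isMinOn hKne (continuous_dirichlet q).continuousOn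
    have hpos : 0 < dirichlet q ν₀ := by
      rcases (dirichlet_nonneg hq ν₀).eq_or_lt with h0 | h0
      · exfalso
        have hfix := symmW_eq_self_of_forall_swap (forall_swap_of_dirichlet_eq_zero hq hq' h0.symm)
        rw [hν₀K.1] at hfix
        have hE := hν₀K.2
        rw [← hfix, energy_def] at hE
        simp at hE
      · exact h0
    refine ⟨dirichlet q ν₀, hpos, fun ν hν => ?_⟩
    rcases (energy_nonneg ν).eq_or_lt with hE0 | hEpos
    · rw [← hE0, mul_zero]; exact dirichlet_nonneg hq ν
    · -- normalise `ν` onto the unit sphere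
      set c : ℝ := Real.sqrt (energy ν) with hc_def
      have hc : 0 < c := Real.sqrt_pos.2 hEpos
      have hcsq : c ^ 2 = energy ν := Real.sq_sqrt (energy_nonneg ν)
      have hmem : c⁻¹ • ν ∈ K := by
        refine ⟨by rw [symmW_smul, hν, smul_zero], ?_⟩
        rw [energy_smul, inv_pow, hcsq, inv_mul_cancel₀ hEpos.ne']
      have hle : dirichlet q ν₀ ≤ dirichlet q (c⁻¹ • ν) := hmin hmem
      rw [dirichlet_smul, inv_pow, hcsq] at hle
      have := mul_le_mul_of_nonneg_left hle (energy_nonneg ν)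
      rw [← mul_assoc, mul_inv_cancel₀ hEpos.ne', one_mul] at this
      rwa [mul_comm]
  · refine ⟨1, one_pos, fun ν hν => ?_⟩
    rcases (energy_nonneg ν).eq_or_lt with hE0 | hEpos
    · rw [← hE0, mul_zero]; exact dirichlet_nonneg hq ν
    · exfalso
      apply hKne
      set c : ℝ := Real.sqrt (energy ν)
      have hcsq : c ^ 2 = energy ν := Real.sq_sqrt (energy_nonneg ν)
      refine ⟨c⁻¹ • ν, by rw [symmW_smul, hν, smul_zero], ?_⟩
      rw [energy_smul, inv_pow, hcsq, inv_mul_cancel₀ hEpos.ne']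

end Gap

/-! ## §5 Convergence to the symmetrization -/

section Convergence

/-- **Exponential convergence to equilibrium in `ℓ²`**: if `q_{i,j} > 0` for all `i ≠ j` there is `λ > 0`
(depending only on the rates) with `E(μT(t) - μ_s) ≤ e^{-λt} E(μ - μ_s)` for every initial weight `μ` and
`t ≥ 0` (Grönwall on `d/dt E = -D ≤ -λE`, valid since `(μT(t) - μ_s)_s = 0`).
[cite: BorceaBrandenLiggett2007, §3.5 ("the limiting measure under the symmetric exclusion evolution with
initial measure `μ` is the symmetrization `μ_s`"), §5 Remark 5.2] [cite: Liggett1985, Ch. VIII] -/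
theorem energy_sepLaw_sub_symmW_le {q : σ → σ → ℝ} (hq : ∀ a b, 0 ≤ q a b) (hq' : ∀ a b, a ≠ b → 0 < q a b) :
    ∃ lam : ℝ, 0 < lam ∧ ∀ (μ : Finset σ → ℝ) (t : ℝ), 0 ≤ t →
      energy (sepLaw q t μ - symmW μ) ≤ Real.exp (-lam * t) * energy (μ - symmW μ) := by
  obtain ⟨lam, hlam, hgap⟩ := exists_gap hq hq'
  refine ⟨lam, hlam, fun μ t ht => ?_⟩
  set ν : Finset σ → ℝ := μ - symmW μ with hν_def
  have hνs : symmW ν = 0 := by rw [hν_def, symmW_sub, symmW_symmW, sub_self]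
  -- `μT(s) - μ_s = νT(s)` for `s ≥ 0`
  have hflow : ∀ s, 0 ≤ s → sepLaw q s μ - symmW μ = sepLaw q s ν := fun s hs => by
    rw [hν_def, sepLaw_sub, sepLaw_symmW hq hs]
  -- the Lyapunov function `f(s) = e^{λ s} E(νT(s))` is non-increasing on `[0, ∞)`
  set f : ℝ → ℝ := fun s => Real.exp (lam * s) * energy (sepLaw q s ν) with hf_def
  have hfd : ∀ s, HasDerivAt f (Real.exp (lam * s) * (lam * 1) * energy (sepLaw q s ν) +
      Real.exp (lam * s) * (-dirichlet q (sepLaw q s ν))) s := fun s => by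
    have h1 : HasDerivAt (fun s => Real.exp (lam * s)) (Real.exp (lam * s) * (lam * 1)) s :=
      ((hasDerivAt_id' s).const_mul lam).exp
    exact h1.mul (hasDerivAt_energy_sepLaw q ν s)
  have hdiff : Differentiable ℝ f := fun s => (hfd s).differentiableAt
  have hderiv_nonpos : ∀ s, 0 ≤ s → deriv f s ≤ 0 := fun s hs => by
    rw [(hfd s).deriv]
    have hsym : symmW (sepLaw q s ν) = 0 := by rw [symmW_sepLaw hq hs, hνs]
    have hg := hgap _ hsym
    have hexp := Real.exp_pos (lam * s)
    nlinarith
  have hanti : AntitoneOn f (Set.Ici 0) :=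
    antitoneOn_of_deriv_nonpos (convex_Ici 0) hdiff.continuous.continuousOn hdiff.differentiableOn
      fun s hs => hderiv_nonpos s (le_of_lt (by simpa [interior_Ici] using hs))
  have hft : f t ≤ f 0 := hanti Set.self_mem_Ici (Set.mem_Ici.2 ht) ht
  have hf0 : f 0 = energy ν := by
    simp only [hf_def, mul_zero, Real.exp_zero, one_mul, sepLaw_zero]
  rw [hflow t ht]
  calc energy (sepLaw q t ν) = Real.exp (-lam * t) * f t := by
        simp only [hf_def]
        rw [← mul_assoc, ← Real.exp_add, neg_mul, neg_add_cancel, Real.exp_zero, one_mul]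
    _ ≤ Real.exp (-lam * t) * energy ν := by
        rw [← hf0]; exact mul_le_mul_of_nonneg_left hft (Real.exp_nonneg _)

/-- **The symmetric exclusion process converges to the symmetrization of its initial law** (BBL §3.5; Remark 5.2:
"if `q_{i,j} > 0` for all `i, j`, then the limiting distribution of `η_t` as `t → ∞` is the symmetrization of the
initial distribution"): `μ T(t) → μ_s`. [cite: BorceaBrandenLiggett2007, §3.5 (before Problem 3.5), §5 Remark 5.2]
[cite: Liggett1985, Ch. VIII] -/
theorem tendsto_sepLaw_atTop {q : σ → σ → ℝ} (hq : ∀ a b, 0 ≤ q a b) (hq' : ∀ a b, a ≠ b → 0 < q a b)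
    (μ : Finset σ → ℝ) : Tendsto (fun t => sepLaw q t μ) atTop (𝓝 (symmW μ)) := by
  obtain ⟨lam, hlam, hbound⟩ := energy_sepLaw_sub_symmW_le hq hq'
  rw [tendsto_pi_nhds]
  intro S
  set E₀ : ℝ := energy (μ - symmW μ)
  have key : ∀ t, 0 ≤ t → |sepLaw q t μ S - symmW μ S| ≤ Real.sqrt (Real.exp (-lam * t) * E₀) := by
    intro t ht
    rw [← Real.sqrt_sq_eq_abs]
    exact Real.sqrt_le_sqrt ((sq_le_energy (sepLaw q t μ - symmW μ) S).trans (hbound μ t ht))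
  have hlim : Tendsto (fun t => Real.sqrt (Real.exp (-lam * t) * E₀)) atTop (𝓝 0) := by
    have h1 : Tendsto (fun t => Real.exp (-lam * t) * E₀) atTop (𝓝 (0 * E₀)) := by
      refine Tendsto.mul_const _ ?_
      have h := Real.tendsto_exp_neg_atTop_nhds_zero.comp (tendsto_id.const_mul_atTop hlam)
      refine h.congr fun t => ?_
      simp only [Function.comp_apply, id, neg_mul]
    rw [zero_mul] at h1
    have h2 := (Real.continuous_sqrt.tendsto 0).comp h1
    rwa [Real.sqrt_zero] at h2
  rw [tendsto_iff_norm_sub_tendsto_zero]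
  refine squeeze_zero' (Eventually.of_forall fun t => norm_nonneg _) ?_ hlim
  filter_upwards [eventually_ge_atTop 0] with t ht
  rw [Real.norm_eq_abs]
  exact key t ht

end Convergence

/-! ## §6 Remark 4.5: the symmetrization of a strongly Rayleigh measure is strongly Rayleigh -/

section Remark45

/-- **Borcea–Brändén–Liggett, Remark 4.5** ("From Theorem 4.20 it follows that the symmetrization `μ_s` of a
strongly Rayleigh measure `μ` is also strongly Rayleigh"): here literally so — `μ_s = lim_{t → ∞} μ T(t)` for the
exclusion process with all rates `1` (`tendsto_sepLaw_atTop`), each `μ T(t)` is strongly Rayleigh by Prop. 5.1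
(`stableOrZero_sepLaw`, itself Theorem 4.20 iterated), and the class is closed (`StableOrZero.of_tendsto`).
[cite: BorceaBrandenLiggett2007, §4.4 Remark 4.5] -/
theorem stableOrZero_symmW {μ : Finset σ → ℝ} (h : StableOrZero μ) : StableOrZero (symmW μ) := by
  have hq : ∀ a b : σ, 0 ≤ (fun _ _ => (1 : ℝ)) a b := fun _ _ => zero_le_one
  have hq' : ∀ a b : σ, a ≠ b → 0 < (fun _ _ => (1 : ℝ)) a b := fun _ _ _ => one_pos
  have hlim := (tendsto_sepLaw_atTop hq hq' μ).comp tendsto_natCast_atTop_atTop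
  exact StableOrZero.of_tendsto hlim fun n => stableOrZero_sepLaw h hq (Nat.cast_nonneg n)

/-- Hence `μ_s` is CNA+ for a strongly Rayleigh nonnegative `μ` (Thm. 4.9). [cite: BorceaBrandenLiggett2007, §4.4
Remark 4.5, §4.2 Thm. 4.9] -/
theorem isCNAPlus_symmW {μ : Finset σ → ℝ} (h : StableOrZero μ) (h0 : ∀ S, 0 ≤ μ S) : IsCNAPlus (symmW μ) :=
  (stableOrZero_symmW h).isCNAPlus (symmW_nonneg h0)

end Remark45

end Literature.Probability.NegativeDependence
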